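import Literature.Probability.RandomPlanarGeometry.LoewnerImageDriverStep
import Literature.Probability.RandomPlanarGeometry.SLERestrictionOneStepKappa
import Literature.Probability.Process.BrownianRunningSupFourthMoment
import HarnessLib

/-!
# The image driving process of SLE_κ, one step (I): conditional mean `(κ/2 − 3) h_t''(W_t) h + o(h)`

Probabilistic half of the one-step analysis of the **image driving value** `W̃_t = h_t(W_t)` of
[LSW] §5 (G. F. Lawler, O. Schramm, W. Werner, *Conformal restriction: the chordal case*, J. Amer.
Math. Soc. **16** (2003), remark after (5.1): "`dW̃_t = h_t'(W_t) dW_t + (κ/2 − 3) h_t''(W_t) dt`";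
at `κ = 6` the drift vanishes — the locality of SLE₆, G. F. Lawler, O. Schramm, W. Werner, Acta
Math. **187** (2001), Thm. 2.2; G. F. Lawler (2005), §6.3 Prop. 6.13), in the conditional-increment
language of the tree (`SLERestrictionOneStep`, `SLERestrictionOneStepKappa`): the deterministic
expansion `ΔW̃ = d x + c₂ x²/2 − 3 c₂ u + O(u(η + u) + u|x| + |x|³)` of `LoewnerImageDriverStep`
is integrated over one step of the SLE_κ driving function `U = √κ B` (a fresh Brownian motion run
for time `h`: the increment driver seen from the base time, by the Markov property).

For ANY `κ > 0` and threshold `c > 0` we PROVE, for every measurable `Z : Ω → ℝ` such that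

* on the good event `{√κ sup_{[0,h]} |B| ≤ c}` (`goodEventK`), `|Z − imageDriverModel d c₂ h x|
  ≤ K (h η + h² + |x|³ + h |x|)` (`x = √κ B_h`, `η = stepSize (√κ runSup h) h`), and
* everywhere `|Z| ≤ M₀ + M₁ sup_{[0,h]} |B|`,

the estimate (`h ≤ 1`, `32 κ h ≤ c²`)

  `|E[Z] − h (κ/2 − 3) c₂| ≤ imageStepC κ c d c₂ K M₀ M₁ · h √h`   (`abs_integral_sub_drift_le`),

with an explicit constant: the mean of the model is `h (κ/2 − 3) c₂` (`E x = 0`, `E x² = κ h`;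
`integral_imageDriverModel`), the good-event remainder integrates to `O(h^{3/2})`
(`integral_imageStepRemainder_le`: `E runSup ≤ 2√h`, `E|x|³ ≤ 2κ√κ h√h`, `E|x| ≤ √κ√h`;
`moments_stepDriverK`), and the bad event has probability `≤ (128κ²/c⁴) h²`
(`measureReal_compl_goodEventK_le`, Doob for `B² − t`), against which `runSup`, `|x|`, `x²`,
`runSup²` are integrated by Cauchy–Schwarz (`setIntegral_compl_goodEventK_le`). The sequel
`SLEImageDriverOneStepVariance` adds the conditional variance `κ d² h + o(h)`, the specialisation to
the flow of a `*`-hull (where the good-event hypothesis is the deterministic expansion) and the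
driftless case `κ = 6`.

No named fact; the definitions are the good event and an explicit constant.

## References

* [LSW] 2003, §5, remark after (5.1). [LawlerSchrammWerner2003Restriction]
* G. F. Lawler, O. Schramm, W. Werner, Acta Math. 187 (2001), Thm. 2.2. [LawlerSchrammWerner2001]
* G. F. Lawler (2005), §4.6.1 (4.35), §6.3 Prop. 6.13. [Lawler2005]
* D. Revuz, M. Yor (1999), Ch. II Thm (1.7) (Doob's inequality). [RevuzYor1999]
-/

noncomputable section

open Set Filter Metric Function MeasureTheory
open _root_.Complex _root_.Topology _root_.Real
open UpperHalfPlane (upperHalfPlaneSet)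
open scoped NNReal ENNReal

namespace Literature.Probability.RandomPlanarGeometry

open Literature.Probability.Process Loewner

/-! ### The increment `x = √κ B_h`: moments -/

/-- `|U_r| ≤ √κ · runSup h` for `r ≤ h` (any `κ`). [folklore] -/
theorem abs_stepDriverK_le_sqrt_mul_runSup (κ : ℝ≥0) {h r : ℝ≥0} (hr : r ≤ h) (ω : ℝ≥0 → ℝ) :
    |stepDriverK κ ω r| ≤ Real.sqrt κ * runSup h ω := by
  rw [stepDriverK_apply, abs_mul, abs_of_nonneg (Real.sqrt_nonneg _)]
  exact mul_le_mul_of_nonneg_left (abs_brownian_le_runSup hr ω) (Real.sqrt_nonneg _)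

/-- **Moments of `x = √κ B_h`**: `E|x| ≤ √κ √h`, `E|x|³ ≤ 2 κ √κ h √h`, `E x⁴ = 3 κ² h²`, with the
integrability of `|x|³`, `x⁴` and the `L²`-membership of `|x|`, `x²`. [folklore] -/
theorem moments_stepDriverK (κ h : ℝ≥0) :
    (∫ ω, |stepDriverK κ ω h| ∂preWienerMeasure ≤ Real.sqrt κ * Real.sqrt h) ∧
    (∫ ω, |stepDriverK κ ω h| ^ 3 ∂preWienerMeasure ≤ 2 * κ * Real.sqrt κ * h * Real.sqrt h) ∧
    (∫ ω, stepDriverK κ ω h ^ 4 ∂preWienerMeasure = 3 * (κ : ℝ) ^ 2 * (h : ℝ) ^ 2) ∧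
    Integrable (fun ω ↦ |stepDriverK κ ω h| ^ 3) preWienerMeasure ∧
    Integrable (fun ω ↦ stepDriverK κ ω h ^ 4) preWienerMeasure ∧
    MemLp (fun ω ↦ |stepDriverK κ ω h|) 2 preWienerMeasure ∧
    MemLp (fun ω ↦ stepDriverK κ ω h ^ 2) 2 preWienerMeasure := by
  have hs0 : 0 ≤ Real.sqrt κ := Real.sqrt_nonneg _
  have hh0 : (0 : ℝ) ≤ h := h.coe_nonneg
  have hfun : ∀ ω, stepDriverK κ ω h = Real.sqrt κ * brownian h ω := fun ω ↦ stepDriverK_apply κ ω h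
  refine ⟨?_, ?_, ?_, ?_, ?_, ?_, ?_⟩
  · have : (fun ω ↦ |stepDriverK κ ω h|) = fun ω ↦ Real.sqrt κ * |brownian h ω| := by
      funext ω; rw [hfun, abs_mul, abs_of_nonneg hs0]
    rw [this, integral_const_mul]
    exact mul_le_mul_of_nonneg_left (integral_abs_brownian_le h) hs0
  · have : (fun ω ↦ |stepDriverK κ ω h| ^ 3) = fun ω ↦ Real.sqrt κ ^ 3 * |brownian h ω| ^ 3 := by
      funext ω; rw [hfun, abs_mul, mul_pow, abs_of_nonneg hs0]
    rw [this, integral_const_mul]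
    have h3 := integral_abs_brownian_pow_three_le h
    have hh32 : (h : ℝ) ^ (3 / 2 : ℝ) = h * Real.sqrt h := by
      rw [show (3 / 2 : ℝ) = 1 + 1 / 2 by norm_num, Real.rpow_add' hh0 (by norm_num), Real.rpow_one,
        Real.sqrt_eq_rpow]
    rw [hh32] at h3
    have hs3 : Real.sqrt 3 ≤ 2 := by rw [Real.sqrt_le_left (by norm_num)]; norm_num
    have hκ3 : Real.sqrt κ ^ 3 = κ * Real.sqrt κ := by
      rw [pow_succ, Real.sq_sqrt (NNReal.coe_nonneg κ)]
    rw [hκ3]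
    have hI0 : 0 ≤ ∫ ω, |brownian h ω| ^ 3 ∂preWienerMeasure := integral_nonneg fun ω ↦ by positivity
    have hm : 0 ≤ (h : ℝ) * Real.sqrt h := by positivity
    calc (κ : ℝ) * Real.sqrt κ * ∫ ω, |brownian h ω| ^ 3 ∂preWienerMeasure
        ≤ κ * Real.sqrt κ * (Real.sqrt 3 * (h * Real.sqrt h)) := mul_le_mul_of_nonneg_left h3 (by positivity)
      _ ≤ κ * Real.sqrt κ * (2 * (h * Real.sqrt h)) := by gcongr
      _ = 2 * κ * Real.sqrt κ * h * Real.sqrt h := by ring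
  · have : (fun ω ↦ stepDriverK κ ω h ^ 4) = fun ω ↦ Real.sqrt κ ^ 4 * brownian h ω ^ 4 := by
      funext ω; rw [hfun, mul_pow]
    rw [this, integral_const_mul, integral_brownian_pow_four,
      show Real.sqrt κ ^ 4 = (Real.sqrt κ ^ 2) ^ 2 by ring, Real.sq_sqrt (NNReal.coe_nonneg κ)]
    ring
  · have : (fun ω ↦ |stepDriverK κ ω h| ^ 3) = fun ω ↦ Real.sqrt κ ^ 3 * |brownian h ω| ^ 3 := by
      funext ω; rw [hfun, abs_mul, mul_pow, abs_of_nonneg hs0]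
    rw [this]; exact (integrable_abs_brownian_pow h 3).const_mul _
  · have : (fun ω ↦ stepDriverK κ ω h ^ 4) = fun ω ↦ Real.sqrt κ ^ 4 * brownian h ω ^ 4 := by
      funext ω; rw [hfun, mul_pow]
    rw [this]; exact (integrable_brownian_pow h 4).const_mul _
  · have : (fun ω ↦ |stepDriverK κ ω h|) = fun ω ↦ Real.sqrt κ * |brownian h ω| := by
      funext ω; rw [hfun, abs_mul, abs_of_nonneg hs0]
    rw [this]; exact ((memLp_brownian h (by simp)).abs).const_mul _
  · have h1 := memLp_two_brownian_sub_sq 0 h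
    simp only [brownian_zero, sub_zero] at h1
    have : (fun ω ↦ stepDriverK κ ω h ^ 2) = fun ω ↦ Real.sqrt κ ^ 2 * brownian h ω ^ 2 := by
      funext ω; rw [hfun, mul_pow]
    rw [this]; exact h1.const_mul _

/-- **The model has mean `h (κ/2 − 3) c₂`** over the increment (`E x = 0`, `E x² = κ h`), and is
integrable. [cite: LawlerSchrammWerner2003Restriction, §5 (remark after (5.1))] -/
theorem integral_imageDriverModel (κ h : ℝ≥0) (d c₂ : ℝ) :
    ∫ ω, imageDriverModel d c₂ h (stepDriverK κ ω h) ∂preWienerMeasure = h * imageDriverDrift κ c₂ ∧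
      Integrable (fun ω ↦ imageDriverModel d c₂ h (stepDriverK κ ω h)) preWienerMeasure := by
  haveI := isProbabilityMeasure_preWienerMeasure'
  obtain ⟨h1, h2, i1, i2⟩ := integral_stepDriverK κ h
  have hfun : (fun ω ↦ imageDriverModel d c₂ h (stepDriverK κ ω h)) = fun ω ↦
      d * stepDriverK κ ω h + (c₂ / 2 * stepDriverK κ ω h ^ 2 - 3 * c₂ * h) := by
    funext ω; rw [imageDriverModel]; ring
  have iB : Integrable (fun ω ↦ c₂ / 2 * stepDriverK κ ω h ^ 2 - 3 * c₂ * h) preWienerMeasure :=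
    (i2.const_mul _).sub (integrable_const _)
  refine ⟨?_, by rw [hfun]; exact (i1.const_mul _).add iB⟩
  rw [hfun, integral_add (i1.const_mul _) iB, integral_const_mul, h1, integral_sub (i2.const_mul _) (integrable_const _),
    integral_const_mul, h2, integral_const, imageDriverDrift]
  simp only [mul_zero, zero_add, probReal_univ, smul_eq_mul, one_mul]
  ring

/-! ### The good event `{√κ sup_{[0,h]} |B| ≤ c}` and the tail of its complement -/

/-- **The good event** `{√κ · sup_{[0,h]} |B| ≤ c}` of one step at diffusivity `κ`. [folklore] -/
def goodEventK (κ : ℝ≥0) (c : ℝ) (h : ℝ≥0) : Set (ℝ≥0 → ℝ) := {ω | Real.sqrt κ * runSup h ω ≤ c}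

/-- The good event is measurable. [folklore] -/
theorem measurableSet_goodEventK (κ : ℝ≥0) (c : ℝ) (h : ℝ≥0) : MeasurableSet (goodEventK κ c h) :=
  measurableSet_le ((measurable_runSup h).const_mul _) measurable_const

/-- **Tail of the bad event**: for `κ > 0`, `c > 0` and `32 κ h ≤ c²`,
`P(√κ runSup h > c) ≤ (128 κ²/c⁴) h²` (`measure_runSup_ge_le` at `a = c/√κ`, `(a/2)² − h ≥ a²/8`).
[cite: RevuzYor1999, Ch. II Thm (1.7)] -/
theorem measureReal_compl_goodEventK_le {κ : ℝ≥0} (hκ : 0 < κ) {c : ℝ} (hc : 0 < c) {h : ℝ≥0}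
    (hh : 32 * (κ : ℝ) * h ≤ c ^ 2) :
    preWienerMeasure.real (goodEventK κ c h)ᶜ ≤ 128 * (κ : ℝ) ^ 2 / c ^ 4 * (h : ℝ) ^ 2 := by
  haveI := isProbabilityMeasure_preWienerMeasure'
  have hκ' : (0 : ℝ) < κ := hκ
  have hs : 0 < Real.sqrt κ := Real.sqrt_pos.2 hκ'
  have hs2 : Real.sqrt κ ^ 2 = κ := Real.sq_sqrt hκ'.le
  set a : ℝ := c / Real.sqrt κ with ha
  have ha0 : 0 < a := by positivity
  have ha2 : a ^ 2 = c ^ 2 / κ := by rw [ha, div_pow, hs2]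
  have hh0 : (0 : ℝ) ≤ h := h.coe_nonneg
  have hha : 8 * (h : ℝ) ≤ a ^ 2 := by
    rw [ha2, le_div_iff₀ hκ']; nlinarith [mul_nonneg hh0 hκ'.le]
  have hlt : (h : ℝ) < (a / 2) ^ 2 := by nlinarith
  have hsub : (goodEventK κ c h)ᶜ ⊆ {ω | a ≤ runSup h ω} := fun ω hω ↦ by
    have : ¬ Real.sqrt κ * runSup h ω ≤ c := hω
    show c / Real.sqrt κ ≤ runSup h ω
    rw [div_le_iff₀ hs]; linarith [not_le.1 this]
  have h1 := (measure_mono hsub).trans (measure_runSup_ge_le h ha0.le hlt)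
  have hbound : 2 * (h : ℝ) ^ 2 / ((a / 2) ^ 2 - h) ^ 2 ≤ 128 * (κ : ℝ) ^ 2 / c ^ 4 * (h : ℝ) ^ 2 := by
    have hden : a ^ 2 / 8 ≤ (a / 2) ^ 2 - h := by linarith
    have hden0 : 0 < a ^ 2 / 8 := by positivity
    calc 2 * (h : ℝ) ^ 2 / ((a / 2) ^ 2 - h) ^ 2 ≤ 2 * (h : ℝ) ^ 2 / (a ^ 2 / 8) ^ 2 := by gcongr
      _ = 128 * (h : ℝ) ^ 2 / (a ^ 2) ^ 2 := by field_simp; ring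
      _ = 128 * (κ : ℝ) ^ 2 / c ^ 4 * (h : ℝ) ^ 2 := by rw [ha2]; field_simp
  rw [measureReal_def]
  calc (preWienerMeasure (goodEventK κ c h)ᶜ).toReal
      ≤ (ENNReal.ofReal (2 * (h : ℝ) ^ 2 / ((a / 2) ^ 2 - h) ^ 2)).toReal :=
        ENNReal.toReal_mono ENNReal.ofReal_ne_top h1
    _ = 2 * (h : ℝ) ^ 2 / ((a / 2) ^ 2 - h) ^ 2 := ENNReal.toReal_ofReal (by positivity)
    _ ≤ _ := hbound

/-- On the good event: `|x| ≤ c` and `η = stepSize (√κ runSup h) h ≤ c + 4√h`. [folklore] -/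
theorem abs_le_of_mem_goodEventK {κ : ℝ≥0} {c : ℝ} {h : ℝ≥0} {ω : ℝ≥0 → ℝ} (hω : ω ∈ goodEventK κ c h) :
    |stepDriverK κ ω h| ≤ c ∧ stepSize (Real.sqrt κ * runSup h ω) h ≤ c + 4 * Real.sqrt h := by
  have h1 : Real.sqrt κ * runSup h ω ≤ c := hω
  exact ⟨(abs_stepDriverK_le_sqrt_mul_runSup κ le_rfl ω).trans h1, by rw [stepSize]; linarith⟩

/-! ### The one-step estimates, abstract form -/

section Abstract

variable {κ : ℝ≥0} {c : ℝ} {h : ℝ≥0} {d c₂ K M₀ M₁ : ℝ} {Z : (ℝ≥0 → ℝ) → ℝ}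
variable (hκ : 0 < κ) (hc0 : 0 < c) (hc1 : c ≤ 1) (hh : 32 * (κ : ℝ) * h ≤ c ^ 2) (hh1 : (h : ℝ) ≤ 1)
  (hK : 0 ≤ K) (hM₀ : 0 ≤ M₀) (hM₁ : 0 ≤ M₁) (hZm : Measurable Z)
  (hgood : ∀ ω ∈ goodEventK κ c h, |Z ω - imageDriverModel d c₂ h (stepDriverK κ ω h)| ≤
    K * (h * stepSize (Real.sqrt κ * runSup h ω) h + h ^ 2 + |stepDriverK κ ω h| ^ 3 + h * |stepDriverK κ ω h|))
  (hbad : ∀ ω, |Z ω| ≤ M₀ + M₁ * runSup h ω)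

/-- **The constant of the first-moment estimate** (`s = √κ`, `p = 128 κ²/c⁴` the tail constant):
`K (3s + 5 + 2κs) + (M₀ + 3|c₂|) p + 2 M₁ √p + |d| s √p + |c₂| κ √p`. [folklore] -/
def imageStepC (κ c d c₂ K M₀ M₁ : ℝ) : ℝ :=
  K * (3 * Real.sqrt κ + 5 + 2 * κ * Real.sqrt κ) + (M₀ + 3 * |c₂|) * (128 * κ ^ 2 / c ^ 4) +
    2 * M₁ * Real.sqrt (128 * κ ^ 2 / c ^ 4) + |d| * Real.sqrt κ * Real.sqrt (128 * κ ^ 2 / c ^ 4) +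
    |c₂| * κ * Real.sqrt (128 * κ ^ 2 / c ^ 4)

include hZm hbad in
/-- `Z` is integrable (it is dominated by `M₀ + M₁ runSup h`). [folklore] -/
theorem integrable_of_abs_le_runSup : Integrable Z preWienerMeasure :=
  ((integrable_const M₀).add ((integrable_runSup h).const_mul M₁)).mono' hZm.aestronglyMeasurable
    (Eventually.of_forall fun ω ↦ by rw [Real.norm_eq_abs]; exact hbad ω)

include hh1 hK in
/-- **The good-event integral of the remainder**: `∫_G K (h η + h² + |x|³ + h|x|) ≤ K (3s + 5 + 2κs) h √h`
(`E runSup ≤ 2√h`, `E|x|³ ≤ 2κ√κ h√h`, `E|x| ≤ √κ √h`, `h² ≤ h √h`). [folklore] -/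
theorem integral_imageStepRemainder_le :
    ∫ ω, K * (h * stepSize (Real.sqrt κ * runSup h ω) h + h ^ 2 + |stepDriverK κ ω h| ^ 3 + h * |stepDriverK κ ω h|)
        ∂preWienerMeasure ≤ K * (3 * Real.sqrt κ + 5 + 2 * κ * Real.sqrt κ) * h * Real.sqrt h ∧
      Integrable (fun ω ↦ K * (h * stepSize (Real.sqrt κ * runSup h ω) h + h ^ 2 + |stepDriverK κ ω h| ^ 3 +
        h * |stepDriverK κ ω h|)) preWienerMeasure := by
  haveI := isProbabilityMeasure_preWienerMeasure'
  obtain ⟨e1, e3, -, i3, -, -, -⟩ := moments_stepDriverK κ h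
  obtain ⟨-, -, i1, -⟩ := integral_stepDriverK κ h
  have hh0 : (0 : ℝ) ≤ h := h.coe_nonneg
  have hs0 : 0 ≤ Real.sqrt κ := Real.sqrt_nonneg _
  have hsh : 0 ≤ Real.sqrt h := Real.sqrt_nonneg _
  have hhs : (h : ℝ) ≤ Real.sqrt h := by rw [Real.le_sqrt hh0 hh0]; nlinarith
  have iη : Integrable (fun ω ↦ stepSize (Real.sqrt κ * runSup h ω) h) preWienerMeasure := by
    have : (fun ω ↦ stepSize (Real.sqrt κ * runSup h ω) h) = fun ω ↦ Real.sqrt κ * runSup h ω + 4 * Real.sqrt h := by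
      funext ω; rw [stepSize]
    rw [this]; exact ((integrable_runSup h).const_mul _).add (integrable_const _)
  have iA : Integrable (fun ω ↦ h * stepSize (Real.sqrt κ * runSup h ω) h + h ^ 2) preWienerMeasure :=
    (iη.const_mul _).add (integrable_const _)
  have iAB : Integrable (fun ω ↦ h * stepSize (Real.sqrt κ * runSup h ω) h + h ^ 2 + |stepDriverK κ ω h| ^ 3)
      preWienerMeasure := iA.add i3
  have iD : Integrable (fun ω ↦ h * |stepDriverK κ ω h|) preWienerMeasure := i1.abs.const_mul _
  have iABD := iAB.add iD
  refine ⟨?_, iABD.const_mul K⟩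
  have eη : ∫ ω, stepSize (Real.sqrt κ * runSup h ω) h ∂preWienerMeasure ≤ (2 * Real.sqrt κ + 4) * Real.sqrt h := by
    have : (fun ω ↦ stepSize (Real.sqrt κ * runSup h ω) h) = fun ω ↦ Real.sqrt κ * runSup h ω + 4 * Real.sqrt h := by
      funext ω; rw [stepSize]
    rw [this, integral_add ((integrable_runSup h).const_mul _) (integrable_const _), integral_const_mul, integral_const]
    simp only [probReal_univ, smul_eq_mul, one_mul]
    have h2 := mul_le_mul_of_nonneg_left (integral_runSup_le h) hs0
    nlinarith
  rw [integral_const_mul, integral_add iAB iD, integral_add iA i3, integral_add (iη.const_mul _) (integrable_const _),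
    integral_const_mul, integral_const_mul, integral_const]
  simp only [probReal_univ, smul_eq_mul, one_mul]
  have f1 := mul_le_mul_of_nonneg_left eη hh0
  have f3 := mul_le_mul_of_nonneg_left e1 hh0
  have hsum : (h : ℝ) * ∫ ω, stepSize (Real.sqrt κ * runSup h ω) h ∂preWienerMeasure + (h : ℝ) ^ 2 +
      ∫ ω, |stepDriverK κ ω h| ^ 3 ∂preWienerMeasure + (h : ℝ) * ∫ ω, |stepDriverK κ ω h| ∂preWienerMeasure ≤
      (3 * Real.sqrt κ + 5 + 2 * κ * Real.sqrt κ) * h * Real.sqrt h := by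
    have hh2 : (h : ℝ) ^ 2 ≤ h * Real.sqrt h := by nlinarith
    nlinarith [mul_nonneg hh0 hsh, mul_nonneg (mul_nonneg hs0 hh0) hsh]
  have := mul_le_mul_of_nonneg_left hsum hK
  linarith

include hκ hc0 hh in
/-- **Cauchy–Schwarz against the bad event**: with `P(Gᶜ) ≤ p h²`, `p = 128κ²/c⁴`,
`∫_{Gᶜ} runSup ≤ 2 √p h √h`, `∫_{Gᶜ} |x| ≤ √κ √p h √h`, `∫_{Gᶜ} x² ≤ 2 κ √p h²`,
`∫_{Gᶜ} runSup² ≤ 5 √p h²` (`E runSup⁴ ≤ 18 h²`). [folklore] -/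
theorem setIntegral_compl_goodEventK_le :
    preWienerMeasure.real (goodEventK κ c h)ᶜ ≤ 128 * (κ : ℝ) ^ 2 / c ^ 4 * (h : ℝ) ^ 2 ∧
    ∫ ω in (goodEventK κ c h)ᶜ, runSup h ω ∂preWienerMeasure ≤
      2 * Real.sqrt (128 * (κ : ℝ) ^ 2 / c ^ 4) * h * Real.sqrt h ∧
    ∫ ω in (goodEventK κ c h)ᶜ, |stepDriverK κ ω h| ∂preWienerMeasure ≤
      Real.sqrt κ * Real.sqrt (128 * (κ : ℝ) ^ 2 / c ^ 4) * h * Real.sqrt h ∧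
    ∫ ω in (goodEventK κ c h)ᶜ, stepDriverK κ ω h ^ 2 ∂preWienerMeasure ≤
      2 * κ * Real.sqrt (128 * (κ : ℝ) ^ 2 / c ^ 4) * (h : ℝ) ^ 2 ∧
    ∫ ω in (goodEventK κ c h)ᶜ, runSup h ω ^ 2 ∂preWienerMeasure ≤
      5 * Real.sqrt (128 * (κ : ℝ) ^ 2 / c ^ 4) * (h : ℝ) ^ 2 := by
  haveI := isProbabilityMeasure_preWienerMeasure'
  obtain ⟨-, -, e4, -, -, m1, m2⟩ := moments_stepDriverK κ h
  obtain ⟨-, e2, -, -⟩ := integral_stepDriverK κ h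
  have hGm := (measurableSet_goodEventK κ c h).compl
  have hh0 : (0 : ℝ) ≤ h := h.coe_nonneg
  set p : ℝ := 128 * (κ : ℝ) ^ 2 / c ^ 4 with hp
  have hp0 : 0 ≤ p := by positivity
  have hP : preWienerMeasure.real (goodEventK κ c h)ᶜ ≤ p * (h : ℝ) ^ 2 := measureReal_compl_goodEventK_le hκ hc0 hh
  have hsqP : Real.sqrt (preWienerMeasure.real (goodEventK κ c h)ᶜ) ≤ Real.sqrt p * h := by
    rw [← Real.sqrt_sq hh0, ← Real.sqrt_mul hp0]; exact Real.sqrt_le_sqrt hP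
  refine ⟨hP, ?_, ?_, ?_, ?_⟩
  · have hmem : MemLp (runSup h) 2 preWienerMeasure :=
      (memLp_two_iff_integrable_sq (measurable_runSup h).aestronglyMeasurable).2 (integrable_runSup_sq h)
    refine (setIntegral_le_sqrt_mul_sqrt hGm (runSup_nonneg h) hmem).trans ?_
    have e : Real.sqrt (∫ ω, runSup h ω ^ 2 ∂preWienerMeasure) ≤ 2 * Real.sqrt h := by
      rw [Real.sqrt_le_left (by positivity)]
      have := integral_runSup_sq_le h
      have h' : (2 * Real.sqrt h) ^ 2 = 4 * h := by rw [mul_pow, Real.sq_sqrt hh0]; ring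
      linarith
    calc _ ≤ Real.sqrt p * h * (2 * Real.sqrt h) := mul_le_mul hsqP e (Real.sqrt_nonneg _) (by positivity)
      _ = _ := by ring
  · refine (setIntegral_le_sqrt_mul_sqrt hGm (fun ω ↦ abs_nonneg _) m1).trans ?_
    have e : Real.sqrt (∫ ω, |stepDriverK κ ω h| ^ 2 ∂preWienerMeasure) ≤ Real.sqrt κ * Real.sqrt h := by
      simp_rw [sq_abs]
      rw [e2, ← Real.sqrt_mul (NNReal.coe_nonneg κ)]
    calc _ ≤ Real.sqrt p * h * (Real.sqrt κ * Real.sqrt h) := mul_le_mul hsqP e (Real.sqrt_nonneg _) (by positivity)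
      _ = _ := by ring
  · refine (setIntegral_le_sqrt_mul_sqrt hGm (fun ω ↦ sq_nonneg _) m2).trans ?_
    have e : Real.sqrt (∫ ω, (stepDriverK κ ω h ^ 2) ^ 2 ∂preWienerMeasure) ≤ 2 * κ * h := by
      have : (fun ω ↦ (stepDriverK κ ω h ^ 2) ^ 2) = fun ω ↦ stepDriverK κ ω h ^ 4 := by
        funext ω; ring
      rw [this, e4, Real.sqrt_le_left (by positivity)]
      nlinarith [sq_nonneg ((κ : ℝ) * h)]
    calc _ ≤ Real.sqrt p * h * (2 * κ * h) := mul_le_mul hsqP e (Real.sqrt_nonneg _) (by positivity)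
      _ = _ := by ring
  · have hmem : MemLp (fun ω ↦ runSup h ω ^ 2) 2 preWienerMeasure :=
      (memLp_two_iff_integrable_sq ((measurable_runSup h).pow_const 2).aestronglyMeasurable).2
        ((integrable_runSup_pow_four h).congr (Eventually.of_forall fun ω ↦ by ring))
    refine (setIntegral_le_sqrt_mul_sqrt hGm (fun ω ↦ sq_nonneg _) hmem).trans ?_
    have e : Real.sqrt (∫ ω, (runSup h ω ^ 2) ^ 2 ∂preWienerMeasure) ≤ 5 * h := by
      have : (fun ω ↦ (runSup h ω ^ 2) ^ 2) = fun ω ↦ runSup h ω ^ 4 := by funext ω; ring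
      rw [this, Real.sqrt_le_left (by positivity)]
      have := integral_runSup_pow_four_le h
      nlinarith [sq_nonneg (h : ℝ)]
    calc _ ≤ Real.sqrt p * h * (5 * h) := mul_le_mul hsqP e (Real.sqrt_nonneg _) (by positivity)
      _ = _ := by ring

include hκ hc0 hh hh1 hK hM₀ hM₁ hZm hgood hbad in
/-- **The one-step conditional mean, abstract form** ([LSW] §5 remark after (5.1), one step of
the SLE_κ flow): under the good/bad hypotheses on `Z`,

  `|E[Z] − h (κ/2 − 3) c₂| ≤ imageStepC κ c d c₂ K M₀ M₁ · h √h`.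

`E[Z] − h (κ/2−3)c₂ = E[Z − model]` (`integral_imageDriverModel`); on the good event the remainder
integrates to `O(h^{3/2})` (`integral_imageStepRemainder_le`); on the bad event
`|Z − model| ≤ M₀ + M₁ runSup + |d||x| + |c₂| x²/2 + 3|c₂| h` is integrated by Cauchy–Schwarz
(`setIntegral_compl_goodEventK_le`). [cite: LawlerSchrammWerner2003Restriction, §5 (remark after (5.1))] -/
theorem abs_integral_sub_drift_le :
    |∫ ω, Z ω ∂preWienerMeasure - h * imageDriverDrift κ c₂| ≤ imageStepC κ c d c₂ K M₀ M₁ * h * Real.sqrt h := by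
  haveI := isProbabilityMeasure_preWienerMeasure'
  obtain ⟨hmodel, iM⟩ := integral_imageDriverModel κ h d c₂
  obtain ⟨hrem, iR⟩ := integral_imageStepRemainder_le (κ := κ) (h := h) (K := K) hh1 hK
  obtain ⟨hP, hRS, hX1, hX2, -⟩ := setIntegral_compl_goodEventK_le (κ := κ) (c := c) (h := h) hκ hc0 hh
  obtain ⟨-, -, i1, i2⟩ := integral_stepDriverK κ h
  have iZ := integrable_of_abs_le_runSup (h := h) hZm hbad
  have hG := measurableSet_goodEventK κ c h
  have hh0 : (0 : ℝ) ≤ h := h.coe_nonneg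
  have hsh : 0 ≤ Real.sqrt h := Real.sqrt_nonneg _
  have hhs : (h : ℝ) ≤ Real.sqrt h := by rw [Real.le_sqrt hh0 hh0]; nlinarith
  have hh2 : (h : ℝ) ^ 2 ≤ h * Real.sqrt h := by nlinarith
  set p : ℝ := 128 * (κ : ℝ) ^ 2 / c ^ 4 with hp
  have hp0 : 0 ≤ p := by positivity
  set F : (ℝ≥0 → ℝ) → ℝ := fun ω ↦ Z ω - imageDriverModel d c₂ h (stepDriverK κ ω h) with hF
  have iF : Integrable F preWienerMeasure := iZ.sub iM
  have hdec : ∫ ω, Z ω ∂preWienerMeasure - h * imageDriverDrift κ c₂ = ∫ ω, F ω ∂preWienerMeasure := by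
    rw [hF, integral_sub iZ iM, hmodel]
  rw [hdec]
  -- good event
  have hgoodInt : ∫ ω in goodEventK κ c h, |F ω| ∂preWienerMeasure ≤
      K * (3 * Real.sqrt κ + 5 + 2 * κ * Real.sqrt κ) * h * Real.sqrt h := by
    have hpos : ∀ ω, 0 ≤ K * (h * stepSize (Real.sqrt κ * runSup h ω) h + h ^ 2 + |stepDriverK κ ω h| ^ 3 +
        h * |stepDriverK κ ω h|) := fun ω ↦ by
      have : 0 ≤ stepSize (Real.sqrt κ * runSup h ω) h := by
        rw [stepSize]; have := runSup_nonneg h ω; positivity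
      positivity
    calc ∫ ω in goodEventK κ c h, |F ω| ∂preWienerMeasure
        ≤ ∫ ω in goodEventK κ c h, K * (h * stepSize (Real.sqrt κ * runSup h ω) h + h ^ 2 + |stepDriverK κ ω h| ^ 3 +
            h * |stepDriverK κ ω h|) ∂preWienerMeasure :=
          setIntegral_mono_on iF.abs.integrableOn iR.integrableOn hG fun ω hω ↦ hgood ω hω
      _ ≤ ∫ ω, K * (h * stepSize (Real.sqrt κ * runSup h ω) h + h ^ 2 + |stepDriverK κ ω h| ^ 3 +
            h * |stepDriverK κ ω h|) ∂preWienerMeasure := setIntegral_le_integral iR (Eventually.of_forall hpos)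
      _ ≤ _ := hrem
  -- bad event: `|F| ≤ M₀ + M₁ runSup + |d||x| + |c₂| x²/2 + 3|c₂| h`
  have hFbad : ∀ ω, |F ω| ≤ (M₀ + 3 * |c₂| * h) + M₁ * runSup h ω + |d| * |stepDriverK κ ω h| +
      |c₂| / 2 * stepDriverK κ ω h ^ 2 := by
    intro ω
    have h1 := hbad ω
    have h2 : |imageDriverModel d c₂ h (stepDriverK κ ω h)| ≤ |d| * |stepDriverK κ ω h| +
        |c₂| / 2 * stepDriverK κ ω h ^ 2 + 3 * |c₂| * h := by
      rw [imageDriverModel]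
      refine (abs_sub _ _).trans (add_le_add ((abs_add_le _ _).trans (add_le_add ?_ ?_)) ?_)
      · rw [abs_mul]
      · rw [abs_div, abs_mul, abs_pow, sq_abs, abs_two]
        exact le_of_eq (by ring)
      · rw [abs_mul, abs_mul, abs_of_nonneg hh0, show |(3 : ℝ)| = 3 by norm_num]
    calc |F ω| = |Z ω - imageDriverModel d c₂ h (stepDriverK κ ω h)| := rfl
      _ ≤ |Z ω| + |imageDriverModel d c₂ h (stepDriverK κ ω h)| := abs_sub _ _
      _ ≤ (M₀ + M₁ * runSup h ω) + (|d| * |stepDriverK κ ω h| + |c₂| / 2 * stepDriverK κ ω h ^ 2 + 3 * |c₂| * h) :=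
          add_le_add h1 h2
      _ = _ := by ring
  have iC : Integrable (fun ω ↦ (M₀ + 3 * |c₂| * h) + M₁ * runSup h ω) preWienerMeasure :=
    (integrable_const _).add ((integrable_runSup h).const_mul _)
  have iCD : Integrable (fun ω ↦ (M₀ + 3 * |c₂| * h) + M₁ * runSup h ω + |d| * |stepDriverK κ ω h|) preWienerMeasure :=
    iC.add (i1.abs.const_mul _)
  have iBad : Integrable (fun ω ↦ (M₀ + 3 * |c₂| * h) + M₁ * runSup h ω + |d| * |stepDriverK κ ω h| +
      |c₂| / 2 * stepDriverK κ ω h ^ 2) preWienerMeasure := iCD.add (i2.const_mul _)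
  have hbadInt : ∫ ω in (goodEventK κ c h)ᶜ, |F ω| ∂preWienerMeasure ≤
      ((M₀ + 3 * |c₂|) * p + 2 * M₁ * Real.sqrt p + |d| * Real.sqrt κ * Real.sqrt p + |c₂| * κ * Real.sqrt p) *
        h * Real.sqrt h := by
    have hdom : ∫ ω in (goodEventK κ c h)ᶜ, |F ω| ∂preWienerMeasure ≤
        ∫ ω in (goodEventK κ c h)ᶜ, ((M₀ + 3 * |c₂| * h) + M₁ * runSup h ω + |d| * |stepDriverK κ ω h| +
          |c₂| / 2 * stepDriverK κ ω h ^ 2) ∂preWienerMeasure :=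
      setIntegral_mono_on iF.abs.integrableOn iBad.integrableOn hG.compl fun ω _ ↦ hFbad ω
    have hsplit : ∫ ω in (goodEventK κ c h)ᶜ, ((M₀ + 3 * |c₂| * h) + M₁ * runSup h ω + |d| * |stepDriverK κ ω h| +
        |c₂| / 2 * stepDriverK κ ω h ^ 2) ∂preWienerMeasure =
        preWienerMeasure.real (goodEventK κ c h)ᶜ * (M₀ + 3 * |c₂| * h) +
          M₁ * ∫ ω in (goodEventK κ c h)ᶜ, runSup h ω ∂preWienerMeasure +
          |d| * ∫ ω in (goodEventK κ c h)ᶜ, |stepDriverK κ ω h| ∂preWienerMeasure +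
          |c₂| / 2 * ∫ ω in (goodEventK κ c h)ᶜ, stepDriverK κ ω h ^ 2 ∂preWienerMeasure := by
      rw [integral_add iCD.integrableOn (i2.const_mul _).integrableOn, integral_add iC.integrableOn (i1.abs.const_mul _).integrableOn,
        integral_add (integrable_const _).integrableOn ((integrable_runSup h).const_mul _).integrableOn,
        integral_const_mul, integral_const_mul, integral_const_mul, setIntegral_const]
      simp only [smul_eq_mul]
    have t1 : preWienerMeasure.real (goodEventK κ c h)ᶜ * (M₀ + 3 * |c₂| * h) ≤ (M₀ + 3 * |c₂|) * p * h * Real.sqrt h := by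
      have f1 : M₀ + 3 * |c₂| * h ≤ M₀ + 3 * |c₂| := by
        have : 3 * |c₂| * h ≤ 3 * |c₂| * 1 := mul_le_mul_of_nonneg_left hh1 (by positivity)
        linarith
      have hq0 : 0 ≤ (M₀ + 3 * |c₂|) * p := by positivity
      calc preWienerMeasure.real (goodEventK κ c h)ᶜ * (M₀ + 3 * |c₂| * h)
          ≤ p * (h : ℝ) ^ 2 * (M₀ + 3 * |c₂|) := mul_le_mul hP f1 (by positivity) (by positivity)
        _ = (M₀ + 3 * |c₂|) * p * (h : ℝ) ^ 2 := by ring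
        _ ≤ (M₀ + 3 * |c₂|) * p * (h * Real.sqrt h) := mul_le_mul_of_nonneg_left hh2 hq0
        _ = _ := by ring
    have t2 : M₁ * ∫ ω in (goodEventK κ c h)ᶜ, runSup h ω ∂preWienerMeasure ≤ 2 * M₁ * Real.sqrt p * h * Real.sqrt h :=
      calc M₁ * ∫ ω in (goodEventK κ c h)ᶜ, runSup h ω ∂preWienerMeasure ≤ M₁ * (2 * Real.sqrt p * h * Real.sqrt h) :=
            mul_le_mul_of_nonneg_left hRS hM₁
        _ = _ := by ring
    have t3 : |d| * ∫ ω in (goodEventK κ c h)ᶜ, |stepDriverK κ ω h| ∂preWienerMeasure ≤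
        |d| * Real.sqrt κ * Real.sqrt p * h * Real.sqrt h :=
      calc |d| * ∫ ω in (goodEventK κ c h)ᶜ, |stepDriverK κ ω h| ∂preWienerMeasure
          ≤ |d| * (Real.sqrt κ * Real.sqrt p * h * Real.sqrt h) := mul_le_mul_of_nonneg_left hX1 (abs_nonneg d)
        _ = _ := by ring
    have t4 : |c₂| / 2 * ∫ ω in (goodEventK κ c h)ᶜ, stepDriverK κ ω h ^ 2 ∂preWienerMeasure ≤
        |c₂| * κ * Real.sqrt p * h * Real.sqrt h := by
      have hq0 : 0 ≤ |c₂| * κ * Real.sqrt p := by positivity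
      calc |c₂| / 2 * ∫ ω in (goodEventK κ c h)ᶜ, stepDriverK κ ω h ^ 2 ∂preWienerMeasure
          ≤ |c₂| / 2 * (2 * κ * Real.sqrt p * (h : ℝ) ^ 2) := mul_le_mul_of_nonneg_left hX2 (by positivity)
        _ = |c₂| * κ * Real.sqrt p * (h : ℝ) ^ 2 := by ring
        _ ≤ |c₂| * κ * Real.sqrt p * (h * Real.sqrt h) := mul_le_mul_of_nonneg_left hh2 hq0
        _ = _ := by ring
    calc _ ≤ _ := hdom
      _ = _ := hsplit
      _ ≤ (M₀ + 3 * |c₂|) * p * h * Real.sqrt h + 2 * M₁ * Real.sqrt p * h * Real.sqrt h +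
          |d| * Real.sqrt κ * Real.sqrt p * h * Real.sqrt h + |c₂| * κ * Real.sqrt p * h * Real.sqrt h :=
          add_le_add (add_le_add (add_le_add t1 t2) t3) t4
      _ = _ := by ring
  -- the two integrals
  have h1 : |∫ ω, F ω ∂preWienerMeasure| ≤ ∫ ω, |F ω| ∂preWienerMeasure := abs_integral_le_integral_abs
  rw [← integral_add_compl hG iF.abs] at h1
  have hC : K * (3 * Real.sqrt κ + 5 + 2 * κ * Real.sqrt κ) * h * Real.sqrt h +
      ((M₀ + 3 * |c₂|) * p + 2 * M₁ * Real.sqrt p + |d| * Real.sqrt κ * Real.sqrt p + |c₂| * κ * Real.sqrt p) *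
        h * Real.sqrt h = imageStepC κ c d c₂ K M₀ M₁ * h * Real.sqrt h := by
    rw [imageStepC, hp]; ring
  linarith

end Abstract

end Literature.Probability.RandomPlanarGeometry

end
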